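import Summits.AnomalousDissipation.AnomalousDissipation.Theorems.SolenoidalFractalHomogenisationLagrangianStepFrameConjugacyAssembly
import HarnessLib

/-!
# K1L_D (stmt-AnomalousDissipation-27980), `stub_Z7_alphaBeta` α-provider: (T4) v2 — `FrameConjugacyAt` from ANY distortion curve, and the
# clamped exact-flow curve (memo L16; helper; `--supports … --as helper`; lead-k1l-onelevel-p1 g5)

`FrameConj.frameConjugacyAt_of` (p697594) fixed the distortion curve to the unclamped `τ ↦ frameG E m (s + τ/a) s` and the frame propagators to
`conjProp E hR m s Um1 / Um`.  `FrameConjugacyAt` itself quantifies the curve `G` and the frame propagators `Ut, Tt` existentially and only asks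
(i) `IsModulation θ (a(t−s)) nC G`, (ii) the two `IsDistortedPropagator … G Ut / Tt`, (iii) the conjugacy / loss identities of `Ut 0 (a(t−s))`,
`Tt 0 (a(t−s))` against `Um1 s t`, `Um s t`.  **`frameConjugacyAt_of_curve`** is that general form (hypotheses `hU0`, `hT0` pin the two
end-to-end maps to `frameRead (a(t−s)) ∘ Um1 s t`, `frameRead (a(t−s)) ∘ Um s t`); **`isModulation_congr_Icc`** moves a modulation datum between
curves that agree on `[0, Tw]`; **`frameConjugacyAt_of_clamped`** is the instance for the CLAMPED curve `τ ↦ frameG E m (s + clamp(τ)/a) s`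
and the clamped conjugate families of `…FrameConjugatePropagatorClamped`, taking the modulation datum for the UNCLAMPED curve (p3's
`isModulation_frameG`).  NOT a proof of the stub, of the crux, or of AD; rung F-D1.A0.
-/

set_option linter.dupNamespace false  -- the summit-side namespace `Summit.AnomalousDissipation.AnomalousDissipation.…` repeats a component by design (D-0017)

noncomputable section

namespace Summit.AnomalousDissipation.AnomalousDissipation.Theorems.SolenoidalFractalHomogenisation.LagrangianStep.FrameConj

open Literature.Analysis Literature.Analysis.FluidPDE Literature.Analysis.FunctionSpaces
open MeasureTheory Set
open scoped InnerProductSpace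
open Literature.Analysis.FluidPDE.LatticeShear (LagrangianLatticeCarrier LatticeWord)
open Summit.AnomalousDissipation.AnomalousDissipation.Theorems.SolenoidalFractalHomogenisation.LagrangianStep.CellClauseMod
open Summit.AnomalousDissipation.AnomalousDissipation.Theorems.SolenoidalFractalHomogenisation.LagrangianStep.Z7Glue

variable {k : ℕ}

/-! ## §1 Modulation data only see `[0, Tw]` -/

/-- `IsModulation θ Tw nC` only evaluates the curve on `Icc 0 Tw`: it transfers between curves that agree there. -/
theorem isModulation_congr_Icc {θ Tw nC : ℝ} {G G' : ℝ → UnitAddTorus (Fin 3) → Matrix (Fin 3) (Fin 3) ℝ} (hTw : 0 ≤ Tw)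
    (h : IsModulation θ Tw nC G) (hGG' : ∀ τ ∈ Icc 0 Tw, G' τ = G τ) : IsModulation θ Tw nC G' := by
  have h0 : G' 0 = G 0 := hGG' 0 ⟨le_rfl, hTw⟩
  refine ⟨fun y => by rw [h0]; exact h.init y, fun τ hτ => by rw [hGG' τ hτ]; exact h.near_one τ hτ,
    fun τ hτ => by rw [hGG' τ hτ]; exact h.det_one τ hτ, fun τ hτ => by rw [hGG' τ hτ]; exact h.piola τ hτ,
    fun τ hτ => by rw [hGG' τ hτ]; exact h.smooth τ hτ, fun τ hτ => by rw [hGG' τ hτ]; exact h.grad_le τ hτ, ?_, ?_⟩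
  · obtain ⟨L, hL⟩ := h.lipschitz
    refine ⟨L, fun y i j => fun t₁ ht₁ t₂ ht₂ => ?_⟩
    have e1 : G' t₁ y i j = G t₁ y i j := by rw [hGG' t₁ ht₁]
    have e2 : G' t₂ y i j = G t₂ y i j := by rw [hGG' t₂ ht₂]
    simp only [e1, e2]
    exact hL y i j ht₁ ht₂
  · obtain ⟨βr, hβ0, hβi, hβθ, hβ⟩ := h.tvar
    refine ⟨βr, hβ0, hβi, hβθ, fun y i j t₁ ht₁ t₂ ht₂ h12 => ?_⟩
    rw [hGG' t₁ ht₁, hGG' t₂ ht₂]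
    exact hβ y i j t₁ ht₁ t₂ ht₂ h12

/-- The clamp `τ ↦ max 0 (min τ Tw)` is the identity on `[0, Tw]`. -/
theorem clamp_eq_self {τ Tw : ℝ} (hτ : τ ∈ Icc 0 Tw) : max 0 (min τ Tw) = τ := by
  rw [min_eq_left hτ.2, max_eq_right hτ.1]

/-! ## §2 (T4) from any curve -/

/-- **(T4), general curve.**  `FrameConjugacyAt` from a modulation datum for an arbitrary curve `G`, two distorted propagators `Ut, Tt` along
`G`, and the identification of their end-to-end maps with the frame readings of `Um1 s t`, `Um s t`. -/
theorem frameConjugacyAt_of_curve {W : LatticeWord k} {M : ℝ} {hM : 0 < M} {c : ℝ} {Φ : ℝ → Torus.Visc4 (Fin 3) → Torus.Visc4 (Fin 3)}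
    {Cα ϱ θ : ℝ} (E : LagrangianLatticeCarrier k) (hR : E.LevelRegular) (m : ℕ) (S : Torus.Visc4 (Fin 3)) {s t : ℝ}
    (hν : 0 < E.cellVisc (m + 1)) (hθ0 : 0 ≤ θ) (hθ : θ ≤ Cα * E.θ (m + 1)) (hϱ : 0 ≤ ϱ)
    {G : ℝ → UnitAddTorus (Fin 3) → Matrix (Fin 3) (Fin 3) ℝ} (hmod : IsModulation θ (E.a (m + 1) * (t - s)) (ϱ * E.N m) G)
    {Um Um1 Ut Tt : ℝ → ℝ → (V2 →L[ℝ] V2)}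
    (hUt : IsDistortedPropagator (E.a (m + 1) * (t - s)) ((1 / (E.N (m + 1) : ℝ) ^ 2) • (E.cellVisc (m + 1) • S))
      (cellField W M hM (E.cellVisc (m + 1)) hν (E.N (m + 1))) G Ut)
    (hTt : IsDistortedPropagator (E.a (m + 1) * (t - s)) ((1 / (E.N (m + 1) : ℝ) ^ 2) • (E.cellVisc (m + 1) • S +
      (c / E.cellVisc (m + 1)) • Φ (E.cellVisc (m + 1)) ((1 / E.cellVisc (m + 1)) • (E.cellVisc (m + 1) • S)))) (fun _ _ => 0) G Tt)
    (hU0 : ∀ x : V2, Ut 0 (E.a (m + 1) * (t - s)) x = frameRead E hR m s (E.a (m + 1) * (t - s)) (Um1 s t x))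
    (hT0 : Tt 0 (E.a (m + 1) * (t - s)) = (frameRead E hR m s (E.a (m + 1) * (t - s))).comp (Um s t)) :
    FrameConjugacyAt W M hM c Φ Cα ϱ E m S Um1 Um s t := by
  have hT0' : ∀ x : V2, Tt 0 (E.a (m + 1) * (t - s)) x = frameRead E hR m s (E.a (m + 1) * (t - s)) (Um s t x) := fun x => by
    rw [hT0, ContinuousLinearMap.comp_apply]
  refine ⟨⟨hν, by linarith⟩, θ, hθ0, hθ, ϱ * E.N m, by positivity, le_rfl, G, hmod, Ut, Tt, hUt, hTt,
    fun x => x, fun y => frameRead E hR m s (E.a (m + 1) * (t - s)) y, ?_, ?_, ?_⟩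
  · -- conjugacy
    intro x y _ _
    rw [hU0, hT0', ← map_sub, inner_frameRead]
  · -- forward loss
    intro x _
    unfold lossFwd
    rw [hT0', norm_frameRead]
  · -- adjoint loss
    intro y _
    unfold lossAdj
    rw [hT0, ContinuousLinearMap.adjoint_comp, ContinuousLinearMap.comp_apply, adjoint_frameRead_apply, norm_frameRead]

/-! ## §3 (T4) for the clamped exact-flow curve -/

/-- **(T4), clamped exact-flow curve.**  `FrameConjugacyAt` from p3's modulation datum for the UNCLAMPED curve `τ ↦ frameG E m (s + τ/a) s`
and the two distorted propagators along the CLAMPED curve with the clamped conjugate families (`…FrameConjugatePropagatorClamped`). -/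
theorem frameConjugacyAt_of_clamped {W : LatticeWord k} {M : ℝ} {hM : 0 < M} {c : ℝ} {Φ : ℝ → Torus.Visc4 (Fin 3) → Torus.Visc4 (Fin 3)}
    {Cα ϱ θ : ℝ} (E : LagrangianLatticeCarrier k) (hR : E.LevelRegular) (m : ℕ) (S : Torus.Visc4 (Fin 3)) {s t : ℝ} (hst : s ≤ t)
    (hν : 0 < E.cellVisc (m + 1)) (hθ0 : 0 ≤ θ) (hθ : θ ≤ Cα * E.θ (m + 1)) (hϱ : 0 ≤ ϱ)
    (hmod : IsModulation θ (E.a (m + 1) * (t - s)) (ϱ * E.N m) (fun τ y => frameG E m (s + τ / E.a (m + 1)) s y))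
    {Um Um1 : ℝ → ℝ → (V2 →L[ℝ] V2)}
    (hUt : IsDistortedPropagator (E.a (m + 1) * (t - s)) ((1 / (E.N (m + 1) : ℝ) ^ 2) • (E.cellVisc (m + 1) • S))
      (cellField W M hM (E.cellVisc (m + 1)) hν (E.N (m + 1)))
      (fun τ y => frameG E m (s + max 0 (min τ (E.a (m + 1) * (t - s))) / E.a (m + 1)) s y)
      (fun σ₁ σ₂ => conjProp E hR m s Um1 (max 0 (min σ₁ (E.a (m + 1) * (t - s)))) (max 0 (min σ₂ (E.a (m + 1) * (t - s))))))
    (hTt : IsDistortedPropagator (E.a (m + 1) * (t - s)) ((1 / (E.N (m + 1) : ℝ) ^ 2) • (E.cellVisc (m + 1) • S +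
      (c / E.cellVisc (m + 1)) • Φ (E.cellVisc (m + 1)) ((1 / E.cellVisc (m + 1)) • (E.cellVisc (m + 1) • S)))) (fun _ _ => 0)
      (fun τ y => frameG E m (s + max 0 (min τ (E.a (m + 1) * (t - s))) / E.a (m + 1)) s y)
      (fun σ₁ σ₂ => conjProp E hR m s Um (max 0 (min σ₁ (E.a (m + 1) * (t - s)))) (max 0 (min σ₂ (E.a (m + 1) * (t - s)))))) :
    FrameConjugacyAt W M hM c Φ Cα ϱ E m S Um1 Um s t := by
  have hTw : 0 ≤ E.a (m + 1) * (t - s) := mul_nonneg (E.a_pos (m + 1)).le (by linarith)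
  have hc0 : max 0 (min 0 (E.a (m + 1) * (t - s))) = 0 := clamp_eq_self ⟨le_rfl, hTw⟩
  have hcT : max 0 (min (E.a (m + 1) * (t - s)) (E.a (m + 1) * (t - s))) = E.a (m + 1) * (t - s) := clamp_eq_self ⟨hTw, le_rfl⟩
  refine frameConjugacyAt_of_curve E hR m S hν hθ0 hθ hϱ (isModulation_congr_Icc hTw hmod fun τ hτ => ?_) hUt hTt (fun x => ?_) ?_
  · simp only [clamp_eq_self hτ]
  · simp only [hc0, hcT]
    exact conjProp_zero_apply E hR m s t Um1 x
  · refine ContinuousLinearMap.ext fun x => ?_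
    simp only [hc0, hcT, ContinuousLinearMap.comp_apply]
    exact conjProp_zero_apply E hR m s t Um x

end Summit.AnomalousDissipation.AnomalousDissipation.Theorems.SolenoidalFractalHomogenisation.LagrangianStep.FrameConj

end
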